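import Mathlib
import HarnessLib
import Summits.HubbardSuperconductivity.HubbardSuperconductivity.Theorems.KLProgrammeKLRegimeAlphaWtMeanFreeBaseDoors
import Summits.HubbardSuperconductivity.HubbardSuperconductivity.Theorems.KLProgrammeKLRegimeEngineSliceFamBandTelClosed
import Summits.HubbardSuperconductivity.HubbardSuperconductivity.Theorems.KLProgrammeKLRegimeEngineSliceMeanFreeChain

/-!
# Route `KLProgramme` — crux K3 ENGINE (stmt-HubbardSuperconductivity-20437) stub (b) conj. 2 «(c-D)² FAMILY TELESCOPE», brick (D5): the
# WEIGHTED α-ROWS OF THE FAT FAMILY AT THE FINAL MEAN-FREE FLOW FRAME `K_n`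

Cell `gate-hubbard-kl`, seat hubbard-kl-k3c3-p2 (g11); F1-DESIGN §10.  KL-regime level: p3's base rows at the mean-free base frame `K♯_{m₀} = K_{m₀} ⊖ Σ_{m₀≤m<n} mean_m`
(`alphaWt_klSliceCov_bgmFat_klEng10_meanFreeBase`, window `4^{m₀+2}U ≤ 4^{2n_f+dd}`) plus the closed simultaneous telescope (`famBandTel_closed`) along the
mean-free chain `K♯_i` (`m₀ ≤ i ≤ n`; `K♯_n = K_n ⊖ 0`; consecutive band increments = mean-free flow pieces, `frameLevel_meanFreeChain_succ_sub`; frames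
admissible by `frameOK_meanFreeBase`; order-three data by `norm_iteratedFDeriv_three_meanFreeChain_le`; jets from `HistP klPredsV17F2`, oscillation from the
hypothesis `hosc`), with `(n − m₀)U² ≤ cc/log 4 ≤ 1` (`IsKLRegime`): for a base index `m₀` with `4^{j+4}16^{n_f} ≤ 4^{m₀}`,

* **`alphaWt_klSliceCov_bgmFat_klEng_meanFreeFinal`** — `∃ C_α(j, dd, R, c″) > 0`: weighted rows/cols of `S(F̃_{n_f}[K♯_n])ᵀ·klSliceCov K♯_n (n_f+j)·S(…)`
  `≤ C_α·(M/β)/Λ_{n_f+j}`.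

Everything is proved; no definitions, no named facts. [cite: BenfattoGiulianiMastropietro2006, §2.8 (2.81), §3 (3.2)–(3.8)]
-/

noncomputable section

namespace Summit.HubbardSuperconductivity.HubbardSuperconductivity.Theorems.TorusFourierL2

set_option linter.dupNamespace false -- summit = problem name (single-conjunct summit), D-0017

open Set Finset Literature.MathematicalPhysics.QuantumLattice Literature.MathematicalPhysics.QuantumLattice.BandSectorCounting
open Literature.MathematicalPhysics.QuantumLattice.FermiRG Literature.Probability.LatticeModels Literature.Analysis.SpecialFunctions
open Summit.HubbardSuperconductivity.HubbardSuperconductivity.Theorems.DispersionFlow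
open Summit.HubbardSuperconductivity.HubbardSuperconductivity.Theorems.KLRegimeSplit
open Summit.HubbardSuperconductivity.HubbardSuperconductivity.Theorems.KLProgrammeLegKernels
open Summit.HubbardSuperconductivity.HubbardSuperconductivity.Theorems.PerturbedFermiCurve
open Summit.HubbardSuperconductivity.HubbardSuperconductivity.Theorems.KLRegimeWick
open Summit.HubbardSuperconductivity.HubbardSuperconductivity.Theorems.EngineV8
open scoped Real Nat

open Classical

set_option maxHeartbeats 4000000 in
/-- **Weighted α-rows/columns of the fat family at the FINAL mean-free flow frame `K♯_n = K_n ⊖ 0`** (see the module docstring): base rows at `K♯_{m₀}` plus the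
closed telescope along the mean-free chain, under (I-F osc) with constant `c″` and the door `c″U ≤ 1`. [cite: BenfattoGiulianiMastropietro2006, §2.8 (2.81), §3 (3.2)–(3.8)] -/
theorem alphaWt_klSliceCov_bgmFat_klEng_meanFreeFinal (j dd : ℕ) (R : RenConsts) (c'' : ℝ) (hc'' : 0 < c'') :
    ∃ Cα : ℝ, 0 < Cα ∧
      ∀ (G : GeoConsts) (P : SplitConsts) (Q : EngConsts) (cc : ℝ), R.WF2 → 0 < cc → cc ≤ EngineV8.klEngC₃6 P R →
      ∀ μ ∈ klWindowC, ∀ U : ℝ, 0 < U → U ≤ min (EngineV8.klEngU₀3 P R cc) (1 / (R.Gfr 3 + 1)) → c'' * U ≤ 1 →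
      ∀ β : ℝ, klBetaMin ≤ β → β ≤ Real.exp (cc / U ^ 2) →
      ∀ (L M : ℕ) [NeZero L] [NeZero M], EngineV8.klEngL₃ β U ≤ L → EngineV8.klEngM₃ β U L ≤ M →
      ∀ n : ℕ, n ≤ nScales β + 1 → IsKLRegime U cc (-(n : ℤ)) → HistP klPredsV17F2 L M G P Q R β U μ 0 n →
        (∀ m < n, FlowPieceOscAt L M c'' β U μ m) →
        ∀ m₀ : ℕ, 1 ≤ m₀ → m₀ ≤ n →
        ∀ nf : ℕ, 1 ≤ nf → nf + j ≤ nScales β + 1 → (4 : ℝ) ^ (m₀ + 2) * U ≤ (4 : ℝ) ^ (2 * nf + dd) → (4 : ℝ) ^ (j + 4) * (16 : ℝ) ^ nf ≤ (4 : ℝ) ^ m₀ →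
        ∀ nw : ℕ, nf + j ≤ nw →
        (∀ Y : SpaceTimeIdx L M × SectorLeg (sectorCount nf),
          ∑ Y', ‖((sectorSubMatrix L M β (bgmFatMultiplier L M klE0 β (nambuXiCT L μ
              (fsub (klFlowFrameU L M β U μ n) (symInterp L fun _ =>
                ∑ m ∈ Ico n n, klAngularMean (klLocalPart L M β U μ (klFlowFrameU L M β U μ m) m)))) nf)).transpose *
            klSliceCov L M β μ (fsub (klFlowFrameU L M β U μ n) (symInterp L fun _ =>
                ∑ m ∈ Ico n n, klAngularMean (klLocalPart L M β U μ (klFlowFrameU L M β U μ m) m))) (nf + j) *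
            sectorSubMatrix L M β (bgmFatMultiplier L M klE0 β (nambuXiCT L μ
              (fsub (klFlowFrameU L M β U μ n) (symInterp L fun _ =>
                ∑ m ∈ Ico n n, klAngularMean (klLocalPart L M β U μ (klFlowFrameU L M β U μ m) m)))) nf)) Y Y'‖ *
              EngineV8.klScaleWt L M β nw {EngineV8.latticeLegPos (2 * (2 * M)) Y, EngineV8.latticeLegPos (2 * (2 * M)) Y'} ≤
            Cα * ((M : ℝ) / β) / klScale klE0 (nf + j)) ∧
        (∀ Y' : SpaceTimeIdx L M × SectorLeg (sectorCount nf),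
          ∑ Y, ‖((sectorSubMatrix L M β (bgmFatMultiplier L M klE0 β (nambuXiCT L μ
              (fsub (klFlowFrameU L M β U μ n) (symInterp L fun _ =>
                ∑ m ∈ Ico n n, klAngularMean (klLocalPart L M β U μ (klFlowFrameU L M β U μ m) m)))) nf)).transpose *
            klSliceCov L M β μ (fsub (klFlowFrameU L M β U μ n) (symInterp L fun _ =>
                ∑ m ∈ Ico n n, klAngularMean (klLocalPart L M β U μ (klFlowFrameU L M β U μ m) m))) (nf + j) *
            sectorSubMatrix L M β (bgmFatMultiplier L M klE0 β (nambuXiCT L μ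
              (fsub (klFlowFrameU L M β U μ n) (symInterp L fun _ =>
                ∑ m ∈ Ico n n, klAngularMean (klLocalPart L M β U μ (klFlowFrameU L M β U μ m) m)))) nf)) Y Y'‖ *
              EngineV8.klScaleWt L M β nw {EngineV8.latticeLegPos (2 * (2 * M)) Y, EngineV8.latticeLegPos (2 * (2 * M)) Y'} ≤
            Cα * ((M : ℝ) / β) / klScale klE0 (nf + j)) := by
  have ha : (-4 : ℝ) < -(6 / 5) := by norm_num
  have hab : (-(6 / 5) : ℝ) ≤ -(1 / 10) := by norm_num
  have hb : (-(1 / 10) : ℝ) < 0 := by norm_num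
  have he : (0 : ℝ) < klE0 := by norm_num [klE0]
  -- if the package is not nonnegative the statement is vacuous (`R.WF2` fails)
  by_cases hRnn : (∀ i, 0 ≤ R.Gfr i) ∧ 0 ≤ R.cr
  swap
  · refine ⟨1, one_pos, ?_⟩
    intro G P Q cc hR2
    exact absurd ⟨EngineV8.gfr_nonneg_of_wf2 hR2, hR2.1.1⟩ hRnn
  obtain ⟨hRj, hcr⟩ := hRnn
  -- the bumped package of the mean-free frames
  set Rb : RenConsts := ⟨R.cr, R.cz, fun i => if i = 0 then R.Gfr 0 + R.cr * klE0 else R.Gfr i⟩ with hRb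
  have hRb0 : Rb.Gfr 0 = R.Gfr 0 + R.cr * klE0 := by simp [hRb]
  have hRbj : ∀ i, i ≠ 0 → Rb.Gfr i = R.Gfr i := fun i hi => by simp [hRb, hi]
  have hRbnn : ∀ i, 0 ≤ Rb.Gfr i := by
    intro i
    by_cases hi : i = 0
    · subst hi; rw [hRb0]; have := hRj 0; positivity
    · rw [hRbj i hi]; exact hRj i
  obtain ⟨Cb, hCb, hbase⟩ := alphaWt_klSliceCov_bgmFat_klEng10_meanFreeBase j dd
  obtain ⟨𝒦, h𝒦, htel⟩ := famBandTel_closed ha hab hb j R Rb hRj hRbnn c'' hc''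
  refine ⟨Cb + 𝒦, by positivity, ?_⟩
  intro G P Q cc hR2 hcc hcc6 μ hμ U hU hUle hcU β hβmin hβc L M _ _ hL3 hM3 n hnN hreg hhist hosc m₀ hm1 hmn nf hnf hnfN hwin hdeep nw hnw
  -- the doors (as in `alphaWt_klSliceCov_bgmFat_klEng10_meanFreeBase`)
  have hcle := (hcc6.trans (EngineV8.klEngC₃6_le_klEngC₃3 P R)).trans (EngineV8.klEngC₃3_le_symbolC₃ ha hab hb P hRj)
  have hcleb : cc ≤ min (min ((bandBounds ha hab hb).Dtmin / 4) ((bandBounds ha hab hb).rhomin / 4)) (1 / 40) / (12 * (Rb.Gfr 2 + 1)) := by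
    rw [hRbj 2 two_ne_zero]; exact hcle
  have hcc480 : cc ≤ 1 / (480 * (R.Gfr 2 + 1)) := by
    refine hcle.trans ?_
    have hG2 : 0 < 12 * (R.Gfr 2 + 1) := by have := hRj 2; positivity
    rw [div_le_div_iff₀ hG2 (by have := hRj 2; positivity)]
    have hk : min (min ((bandBounds ha hab hb).Dtmin / 4) ((bandBounds ha hab hb).rhomin / 4)) (1 / 40) ≤ 1 / 40 := min_le_right _ _
    nlinarith [hk, hRj 2]
  have hcc1 : cc ≤ 1 := hcc480.trans (by rw [div_le_one (by have := hRj 2; positivity)]; nlinarith [hRj 2])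
  have hU3 : U ≤ EngineV8.klEngU₀3 P R cc := hUle.trans (min_le_left _ _)
  have hU3R := EngineV8.klEngU₀3_le_symbolU₀ ha hab hb P hRj cc
  have hU1 : U ≤ 1 := hU3.trans (hU3R.trans (min_le_left _ _))
  have hUd : U ≤ 1 / (2 ^ 12 * (R.Gfr 0 + R.Gfr 1 + R.cr + 1)) := hU3.trans (klEngU₀3_le_inv_baseDoor P (hRj 0) (hRj 1) hcr cc)
  have hG1U : R.Gfr 1 * U ≤ 1 := by
    have h1 := hRj 1; have h0 := hRj 0
    calc R.Gfr 1 * U ≤ R.Gfr 1 * (1 / (2 ^ 12 * (R.Gfr 0 + R.Gfr 1 + R.cr + 1))) := mul_le_mul_of_nonneg_left hUd h1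
      _ ≤ 1 := by rw [mul_one_div, div_le_one (by positivity)]; nlinarith [h0, h1, hcr]
  have hU3b : U ≤ min 1 (min (min ((bandBounds ha hab hb).Dtmin / 4) ((bandBounds ha hab hb).rhomin / 4)) (1 / 40) /
      (24 * (Rb.Gfr 0 + Rb.Gfr 1 + 1))) := by
    rw [hRb0, hRbj 1 one_ne_zero, EngineV8.symbolKappa_eq ha hab hb]
    exact hU3.trans (klEngU₀3_le_min_div_bumped P (hRj 0) (hRj 1) hcr cc)
  have hLβ : β ^ 2 ≤ (L : ℝ) := EngineV8.sq_le_of_klEngL₃_le hL3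
  have hMβ : β ≤ (M : ℝ) := EngineV8.le_of_klEngM₃_le hβmin hL3 hM3
  have hβ0 : 0 < β := pos_of_klBetaMin_le hβmin
  have hM0 : (0 : ℝ) < M := lt_of_lt_of_le hβ0 hMβ
  have hΛ : 0 < klScale klE0 (nf + j) := klth_klScale_pos _
  -- the base rows at `K♯_{m₀}`
  have hb0 := hbase G P R Q cc hR2 hcc hcc6 μ hμ U hU hUle β hβmin hβc L M hL3 hM3 n hnN hreg hhist m₀ hm1 hmn nf hnf hnfN hwin nw hnw
  -- the mean-free chain and the telescope from `m₀` to `n`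
  have hh := (histP_klPredsV17F2_iff L M G P Q R β U μ 0 n).1 hhist
  have ht := htel cc U hcc hcleb hU hU3b hG1U hcU β hβmin hβc μ hμ L M hLβ hMβ
    (fun i => fsub (klFlowFrameU L M β U μ i) (symInterp L fun _ => ∑ m ∈ Ico i n, klAngularMean (klLocalPart L M β U μ (klFlowFrameU L M β U μ m) m)))
    m₀ (n - m₀)
    (fun i h1 h2 => frameOK_meanFreeBase hR2 hμ hU hU1 hUd hcc.le hcc480 hreg (hm1.trans h1) (by omega) hnN hhist)
    (fun i h1 h2 p => (norm_iteratedFDeriv_three_meanFreeChain_le (n := n) hRj (fun m' hm' => (hh m' (by omega)).2.1.2.1) p).1)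
    (fun i h1 h2 p => (norm_iteratedFDeriv_three_meanFreeChain_le (n := n) hRj (fun m' hm' => (hh m' (by omega)).2.1.2.1) p).2)
    (fun i h1 h2 => (hh i (by omega)).2.1.2.1) (fun i h1 h2 => hosc i (by omega))
    (fun i h1 h2 => frameLevel_meanFreeChain_succ_sub β U μ (by omega)) nf hnf hnfN hdeep nw hnw
  rw [show m₀ + (n - m₀) = n by omega] at ht
  obtain ⟨hrows, hcols⟩ := ht
  -- `(n − m₀)·U² ≤ cc/log 4 ≤ 1`
  have hlog : 1 ≤ Real.log 4 := by
    have h4 : Real.exp 1 ≤ 4 := by have := Real.exp_one_lt_d9; norm_num at this; linarith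
    calc (1 : ℝ) = Real.log (Real.exp 1) := (Real.log_exp 1).symm
      _ ≤ Real.log 4 := Real.log_le_log (Real.exp_pos 1) h4
  have hdnU : ((n - m₀ : ℕ) : ℝ) * U ^ 2 ≤ 1 := by
    have hr : U ^ 2 * |((-(n : ℤ) : ℤ) : ℝ)| * Real.log 4 ≤ cc := hreg
    rw [show |((-(n : ℤ) : ℤ) : ℝ)| = (n : ℝ) by push_cast; rw [abs_neg]; exact abs_of_nonneg (Nat.cast_nonneg n)] at hr
    have hdn : ((n - m₀ : ℕ) : ℝ) ≤ (n : ℝ) := by exact_mod_cast Nat.sub_le n m₀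
    have h1 : (n : ℝ) * U ^ 2 ≤ (n : ℝ) * U ^ 2 * Real.log 4 := le_mul_of_one_le_right (by positivity) hlog
    nlinarith [hdn, h1, hr, hcc1, sq_nonneg U]
  have hinc : ((n - m₀ : ℕ) : ℝ) * (𝒦 * U ^ 2 * ((M : ℝ) / β) / klScale klE0 (nf + j)) ≤ 𝒦 * ((M : ℝ) / β) / klScale klE0 (nf + j) := by
    have hpos : 0 ≤ 𝒦 * ((M : ℝ) / β) / klScale klE0 (nf + j) := by positivity
    calc ((n - m₀ : ℕ) : ℝ) * (𝒦 * U ^ 2 * ((M : ℝ) / β) / klScale klE0 (nf + j)) = (((n - m₀ : ℕ) : ℝ) * U ^ 2) * (𝒦 * ((M : ℝ) / β) / klScale klE0 (nf + j)) := by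
          ring
      _ ≤ 1 * (𝒦 * ((M : ℝ) / β) / klScale klE0 (nf + j)) := mul_le_mul_of_nonneg_right hdnU hpos
      _ = _ := one_mul _
  have etot : (Cb + 𝒦) * ((M : ℝ) / β) / klScale klE0 (nf + j) = Cb * ((M : ℝ) / β) / klScale klE0 (nf + j) + 𝒦 * ((M : ℝ) / β) / klScale klE0 (nf + j) := by ring
  rw [etot]
  exact ⟨fun Y => (hrows Y).trans (add_le_add (hb0.1 Y) hinc), fun Y' => (hcols Y').trans (add_le_add (hb0.2 Y') hinc)⟩

set_option maxHeartbeats 4000000 in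
/-- **The same, with the REGISTERED (K5′) history binder** `∀ m, 1 ≤ m → m < n → FlowPieceOscAt … m` (stub (b) rev 14, token #25: the clause starts at `m = 1`).
The telescope only reads the clauses at `m ≥ m₀ ≥ 1`, so the proof is verbatim; this is the form consumers (…AlphaWtFlowAllReg, E1's (I1′)) apply from (b)'s binders.
(k3c3-p2 g12, appended.) [cite: BenfattoGiulianiMastropietro2006, §2.8 (2.81), §3 (3.2)–(3.8)] -/
theorem alphaWt_klSliceCov_bgmFat_klEng_meanFreeFinal' (j dd : ℕ) (R : RenConsts) (c'' : ℝ) (hc'' : 0 < c'') :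
    ∃ Cα : ℝ, 0 < Cα ∧
      ∀ (G : GeoConsts) (P : SplitConsts) (Q : EngConsts) (cc : ℝ), R.WF2 → 0 < cc → cc ≤ EngineV8.klEngC₃6 P R →
      ∀ μ ∈ klWindowC, ∀ U : ℝ, 0 < U → U ≤ min (EngineV8.klEngU₀3 P R cc) (1 / (R.Gfr 3 + 1)) → c'' * U ≤ 1 →
      ∀ β : ℝ, klBetaMin ≤ β → β ≤ Real.exp (cc / U ^ 2) →
      ∀ (L M : ℕ) [NeZero L] [NeZero M], EngineV8.klEngL₃ β U ≤ L → EngineV8.klEngM₃ β U L ≤ M →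
      ∀ n : ℕ, n ≤ nScales β + 1 → IsKLRegime U cc (-(n : ℤ)) → HistP klPredsV17F2 L M G P Q R β U μ 0 n →
        (∀ m, 1 ≤ m → m < n → FlowPieceOscAt L M c'' β U μ m) →
        ∀ m₀ : ℕ, 1 ≤ m₀ → m₀ ≤ n →
        ∀ nf : ℕ, 1 ≤ nf → nf + j ≤ nScales β + 1 → (4 : ℝ) ^ (m₀ + 2) * U ≤ (4 : ℝ) ^ (2 * nf + dd) → (4 : ℝ) ^ (j + 4) * (16 : ℝ) ^ nf ≤ (4 : ℝ) ^ m₀ →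
        ∀ nw : ℕ, nf + j ≤ nw →
        (∀ Y : SpaceTimeIdx L M × SectorLeg (sectorCount nf),
          ∑ Y', ‖((sectorSubMatrix L M β (bgmFatMultiplier L M klE0 β (nambuXiCT L μ
              (fsub (klFlowFrameU L M β U μ n) (symInterp L fun _ =>
                ∑ m ∈ Ico n n, klAngularMean (klLocalPart L M β U μ (klFlowFrameU L M β U μ m) m)))) nf)).transpose *
            klSliceCov L M β μ (fsub (klFlowFrameU L M β U μ n) (symInterp L fun _ =>
                ∑ m ∈ Ico n n, klAngularMean (klLocalPart L M β U μ (klFlowFrameU L M β U μ m) m))) (nf + j) *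
            sectorSubMatrix L M β (bgmFatMultiplier L M klE0 β (nambuXiCT L μ
              (fsub (klFlowFrameU L M β U μ n) (symInterp L fun _ =>
                ∑ m ∈ Ico n n, klAngularMean (klLocalPart L M β U μ (klFlowFrameU L M β U μ m) m)))) nf)) Y Y'‖ *
              EngineV8.klScaleWt L M β nw {EngineV8.latticeLegPos (2 * (2 * M)) Y, EngineV8.latticeLegPos (2 * (2 * M)) Y'} ≤
            Cα * ((M : ℝ) / β) / klScale klE0 (nf + j)) ∧
        (∀ Y' : SpaceTimeIdx L M × SectorLeg (sectorCount nf),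
          ∑ Y, ‖((sectorSubMatrix L M β (bgmFatMultiplier L M klE0 β (nambuXiCT L μ
              (fsub (klFlowFrameU L M β U μ n) (symInterp L fun _ =>
                ∑ m ∈ Ico n n, klAngularMean (klLocalPart L M β U μ (klFlowFrameU L M β U μ m) m)))) nf)).transpose *
            klSliceCov L M β μ (fsub (klFlowFrameU L M β U μ n) (symInterp L fun _ =>
                ∑ m ∈ Ico n n, klAngularMean (klLocalPart L M β U μ (klFlowFrameU L M β U μ m) m))) (nf + j) *
            sectorSubMatrix L M β (bgmFatMultiplier L M klE0 β (nambuXiCT L μ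
              (fsub (klFlowFrameU L M β U μ n) (symInterp L fun _ =>
                ∑ m ∈ Ico n n, klAngularMean (klLocalPart L M β U μ (klFlowFrameU L M β U μ m) m)))) nf)) Y Y'‖ *
              EngineV8.klScaleWt L M β nw {EngineV8.latticeLegPos (2 * (2 * M)) Y, EngineV8.latticeLegPos (2 * (2 * M)) Y'} ≤
            Cα * ((M : ℝ) / β) / klScale klE0 (nf + j)) := by
  have ha : (-4 : ℝ) < -(6 / 5) := by norm_num
  have hab : (-(6 / 5) : ℝ) ≤ -(1 / 10) := by norm_num
  have hb : (-(1 / 10) : ℝ) < 0 := by norm_num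
  have he : (0 : ℝ) < klE0 := by norm_num [klE0]
  -- if the package is not nonnegative the statement is vacuous (`R.WF2` fails)
  by_cases hRnn : (∀ i, 0 ≤ R.Gfr i) ∧ 0 ≤ R.cr
  swap
  · refine ⟨1, one_pos, ?_⟩
    intro G P Q cc hR2
    exact absurd ⟨EngineV8.gfr_nonneg_of_wf2 hR2, hR2.1.1⟩ hRnn
  obtain ⟨hRj, hcr⟩ := hRnn
  -- the bumped package of the mean-free frames
  set Rb : RenConsts := ⟨R.cr, R.cz, fun i => if i = 0 then R.Gfr 0 + R.cr * klE0 else R.Gfr i⟩ with hRb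
  have hRb0 : Rb.Gfr 0 = R.Gfr 0 + R.cr * klE0 := by simp [hRb]
  have hRbj : ∀ i, i ≠ 0 → Rb.Gfr i = R.Gfr i := fun i hi => by simp [hRb, hi]
  have hRbnn : ∀ i, 0 ≤ Rb.Gfr i := by
    intro i
    by_cases hi : i = 0
    · subst hi; rw [hRb0]; have := hRj 0; positivity
    · rw [hRbj i hi]; exact hRj i
  obtain ⟨Cb, hCb, hbase⟩ := alphaWt_klSliceCov_bgmFat_klEng10_meanFreeBase j dd
  obtain ⟨𝒦, h𝒦, htel⟩ := famBandTel_closed ha hab hb j R Rb hRj hRbnn c'' hc''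
  refine ⟨Cb + 𝒦, by positivity, ?_⟩
  intro G P Q cc hR2 hcc hcc6 μ hμ U hU hUle hcU β hβmin hβc L M _ _ hL3 hM3 n hnN hreg hhist hosc m₀ hm1 hmn nf hnf hnfN hwin hdeep nw hnw
  -- the doors (as in `alphaWt_klSliceCov_bgmFat_klEng10_meanFreeBase`)
  have hcle := (hcc6.trans (EngineV8.klEngC₃6_le_klEngC₃3 P R)).trans (EngineV8.klEngC₃3_le_symbolC₃ ha hab hb P hRj)
  have hcleb : cc ≤ min (min ((bandBounds ha hab hb).Dtmin / 4) ((bandBounds ha hab hb).rhomin / 4)) (1 / 40) / (12 * (Rb.Gfr 2 + 1)) := by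
    rw [hRbj 2 two_ne_zero]; exact hcle
  have hcc480 : cc ≤ 1 / (480 * (R.Gfr 2 + 1)) := by
    refine hcle.trans ?_
    have hG2 : 0 < 12 * (R.Gfr 2 + 1) := by have := hRj 2; positivity
    rw [div_le_div_iff₀ hG2 (by have := hRj 2; positivity)]
    have hk : min (min ((bandBounds ha hab hb).Dtmin / 4) ((bandBounds ha hab hb).rhomin / 4)) (1 / 40) ≤ 1 / 40 := min_le_right _ _
    nlinarith [hk, hRj 2]
  have hcc1 : cc ≤ 1 := hcc480.trans (by rw [div_le_one (by have := hRj 2; positivity)]; nlinarith [hRj 2])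
  have hU3 : U ≤ EngineV8.klEngU₀3 P R cc := hUle.trans (min_le_left _ _)
  have hU3R := EngineV8.klEngU₀3_le_symbolU₀ ha hab hb P hRj cc
  have hU1 : U ≤ 1 := hU3.trans (hU3R.trans (min_le_left _ _))
  have hUd : U ≤ 1 / (2 ^ 12 * (R.Gfr 0 + R.Gfr 1 + R.cr + 1)) := hU3.trans (klEngU₀3_le_inv_baseDoor P (hRj 0) (hRj 1) hcr cc)
  have hG1U : R.Gfr 1 * U ≤ 1 := by
    have h1 := hRj 1; have h0 := hRj 0
    calc R.Gfr 1 * U ≤ R.Gfr 1 * (1 / (2 ^ 12 * (R.Gfr 0 + R.Gfr 1 + R.cr + 1))) := mul_le_mul_of_nonneg_left hUd h1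
      _ ≤ 1 := by rw [mul_one_div, div_le_one (by positivity)]; nlinarith [h0, h1, hcr]
  have hU3b : U ≤ min 1 (min (min ((bandBounds ha hab hb).Dtmin / 4) ((bandBounds ha hab hb).rhomin / 4)) (1 / 40) /
      (24 * (Rb.Gfr 0 + Rb.Gfr 1 + 1))) := by
    rw [hRb0, hRbj 1 one_ne_zero, EngineV8.symbolKappa_eq ha hab hb]
    exact hU3.trans (klEngU₀3_le_min_div_bumped P (hRj 0) (hRj 1) hcr cc)
  have hLβ : β ^ 2 ≤ (L : ℝ) := EngineV8.sq_le_of_klEngL₃_le hL3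
  have hMβ : β ≤ (M : ℝ) := EngineV8.le_of_klEngM₃_le hβmin hL3 hM3
  have hβ0 : 0 < β := pos_of_klBetaMin_le hβmin
  have hM0 : (0 : ℝ) < M := lt_of_lt_of_le hβ0 hMβ
  have hΛ : 0 < klScale klE0 (nf + j) := klth_klScale_pos _
  -- the base rows at `K♯_{m₀}`
  have hb0 := hbase G P R Q cc hR2 hcc hcc6 μ hμ U hU hUle β hβmin hβc L M hL3 hM3 n hnN hreg hhist m₀ hm1 hmn nf hnf hnfN hwin nw hnw
  -- the mean-free chain and the telescope from `m₀` to `n`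
  have hh := (histP_klPredsV17F2_iff L M G P Q R β U μ 0 n).1 hhist
  have ht := htel cc U hcc hcleb hU hU3b hG1U hcU β hβmin hβc μ hμ L M hLβ hMβ
    (fun i => fsub (klFlowFrameU L M β U μ i) (symInterp L fun _ => ∑ m ∈ Ico i n, klAngularMean (klLocalPart L M β U μ (klFlowFrameU L M β U μ m) m)))
    m₀ (n - m₀)
    (fun i h1 h2 => frameOK_meanFreeBase hR2 hμ hU hU1 hUd hcc.le hcc480 hreg (hm1.trans h1) (by omega) hnN hhist)
    (fun i h1 h2 p => (norm_iteratedFDeriv_three_meanFreeChain_le (n := n) hRj (fun m' hm' => (hh m' (by omega)).2.1.2.1) p).1)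
    (fun i h1 h2 p => (norm_iteratedFDeriv_three_meanFreeChain_le (n := n) hRj (fun m' hm' => (hh m' (by omega)).2.1.2.1) p).2)
    (fun i h1 h2 => (hh i (by omega)).2.1.2.1) (fun i h1 h2 => hosc i (by omega) (by omega))
    (fun i h1 h2 => frameLevel_meanFreeChain_succ_sub β U μ (by omega)) nf hnf hnfN hdeep nw hnw
  rw [show m₀ + (n - m₀) = n by omega] at ht
  obtain ⟨hrows, hcols⟩ := ht
  -- `(n − m₀)·U² ≤ cc/log 4 ≤ 1`
  have hlog : 1 ≤ Real.log 4 := by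
    have h4 : Real.exp 1 ≤ 4 := by have := Real.exp_one_lt_d9; norm_num at this; linarith
    calc (1 : ℝ) = Real.log (Real.exp 1) := (Real.log_exp 1).symm
      _ ≤ Real.log 4 := Real.log_le_log (Real.exp_pos 1) h4
  have hdnU : ((n - m₀ : ℕ) : ℝ) * U ^ 2 ≤ 1 := by
    have hr : U ^ 2 * |((-(n : ℤ) : ℤ) : ℝ)| * Real.log 4 ≤ cc := hreg
    rw [show |((-(n : ℤ) : ℤ) : ℝ)| = (n : ℝ) by push_cast; rw [abs_neg]; exact abs_of_nonneg (Nat.cast_nonneg n)] at hr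
    have hdn : ((n - m₀ : ℕ) : ℝ) ≤ (n : ℝ) := by exact_mod_cast Nat.sub_le n m₀
    have h1 : (n : ℝ) * U ^ 2 ≤ (n : ℝ) * U ^ 2 * Real.log 4 := le_mul_of_one_le_right (by positivity) hlog
    nlinarith [hdn, h1, hr, hcc1, sq_nonneg U]
  have hinc : ((n - m₀ : ℕ) : ℝ) * (𝒦 * U ^ 2 * ((M : ℝ) / β) / klScale klE0 (nf + j)) ≤ 𝒦 * ((M : ℝ) / β) / klScale klE0 (nf + j) := by
    have hpos : 0 ≤ 𝒦 * ((M : ℝ) / β) / klScale klE0 (nf + j) := by positivity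
    calc ((n - m₀ : ℕ) : ℝ) * (𝒦 * U ^ 2 * ((M : ℝ) / β) / klScale klE0 (nf + j)) = (((n - m₀ : ℕ) : ℝ) * U ^ 2) * (𝒦 * ((M : ℝ) / β) / klScale klE0 (nf + j)) := by
          ring
      _ ≤ 1 * (𝒦 * ((M : ℝ) / β) / klScale klE0 (nf + j)) := mul_le_mul_of_nonneg_right hdnU hpos
      _ = _ := one_mul _
  have etot : (Cb + 𝒦) * ((M : ℝ) / β) / klScale klE0 (nf + j) = Cb * ((M : ℝ) / β) / klScale klE0 (nf + j) + 𝒦 * ((M : ℝ) / β) / klScale klE0 (nf + j) := by ring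
  rw [etot]
  exact ⟨fun Y => (hrows Y).trans (add_le_add (hb0.1 Y) hinc), fun Y' => (hcols Y').trans (add_le_add (hb0.2 Y') hinc)⟩

end Summit.HubbardSuperconductivity.HubbardSuperconductivity.Theorems.TorusFourierL2

end
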